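import Summits.QuantumFields.YangMills.Theorems.BalabanUVNodesN11CondExpOfFibrewiseIdentity

/-!
# DAG node N11 — THE FROZEN-`y` FIBREWISE IDENTITY FROM A `y`-PARAMETRISED FAMILY OF FIBRE CHARTS: per frozen retained configuration `y`, ONE chart of the inside variables
# `(hpush_y, hsec_y)` on ONE fibre and ONE reading identity `∫ J_y ρ_y(Ψ_y) dκ_y = R̃(y,·)` — NO measurability in `y`, NO skew-product assembly, NO kernel

HEADER — WORK-UNIT METADATA.  Cell `pub-ymgap`, YM-PLAN Track A (D-0062), seat `pub-ymgap-dag-n11-d` (g17; N11 [B14], s2), route `BalabanUVNodes`, item K1⁹ = stmt-QuantumFields-27364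
(helper lane, `--kind proof --supports 27364 --as helper`, count-neutral).  [I] = [Balaban1987RG1], [III] = [Balaban1988Convergent], [15] = [Balaban1985Variational].  The tested
Bochner form of this seat's g14 fibre-chart socket `…N11KernelTransportInFibreChart` (`integral_comp_avg_mul_eq_chart`, `(κ, Ψ, J, S; hpush, hfib)`) RE-PROVED for a merely
INTEGRABLE density (no Borel-measurable version asked — the old-branch pieces of record are known integrable, p625485, not pointwise Borel), composed with this seat's g17
`…N11CondExpOfFibrewiseIdentity` (the Fubini reduction: (hweak) and (hce₀) from the frozen-`y` fibrewise identity).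

WHY THIS FILE.  After `…N11CondExpOfFibrewiseIdentity` the (O3′) debt of a §3 supplier per 𝐓-present child and old branch is the frozen-`y` identity
  (hfib)  for a.e. `y` and every bounded measurable `h` of the new variables:  ∫ ρ_y(u)·h(φ_y(u)) dν(u) = ∫ R̃(y,v)·h(v) dμ₂(v),   `ρ_y := piece ∘ e⁻¹(y,·)`, `φ_y(u) := Ū(e⁻¹(y,u))|_{new}`.
On ONE fibre this is a statement about ONE measurable map `φ_y : (sVᶜ → SU(N)) → (sV'ᶜ → SU(N))` between two finite product-Haar spaces, and print's way to prove it ([I] §2,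
[III] p.267 «we remove the δ-functions using the operator C», [15] (47)–(49)) is a CHART of the inside variables: coordinates `(v, x)`, `u = Ψ_y(v, x)` parametrising the fibre
`φ_y = v`, with Jacobian `J_y(v,x)` against `dμ₂(v) κ_y(v, dx)` on the charted (small-field) set `S_y`.  g14's socket turns such a chart into the tested form
`∫ ρ_y(u) h(φ_y u) dν = ∫ h(v) (∫ J_y(v,x) ρ_y(Ψ_y(v,x)) κ_y(v,dx)) dμ₂(v)`, so (hfib) holds with ANY candidate `R̃(y,·)` that is `μ₂`-a.e. the chart integral.  Because the
Fubini reduction needs (hfib) only for a.e. `y` SEPARATELY, the charts may depend on `y` ARBITRARILY: no joint measurability of `(y,v,x) ↦ Ψ_y(v,x)`, no skew-product chart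
(dag-n11-w2's `…KernelTransportSkewProduct` §3), no `kernelTransport` version caveat — the supplier's formal burden per `(s′, S₀, y)` is: `Ψ_y`, `J_y` measurable, `hpush_y`,
`hsec_y`, the support clause `ρ_y = 0` off `S_y`, and the reading `∫ J_y ρ_y(Ψ_y) dκ_y =ᵐ R̃(y,·)`.

WHAT THIS FILE PROVES (0 `def`, 0 `sorry`, standard axioms).  §1 (one fibre, generic): ★ `fibre_identity_of_chart` · `fibre_identity_of_chart_univ` (charted set `= univ`).
§2 (record letters, ANY `dU`-integrable `ρ`, any finite bond sets, a `y`-parametrised chart family): ★★ `fibrewise_at_record_of_fibreCharts` ((hfib) from the charts) ·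
★★★ `weak_at_record_of_fibreCharts` (p646357's (hweak) from the charts) · ★★★ `condExp_identity_of_fibreCharts_of_nonneg` ((hce₀) at 11a's letters from the charts, candidate
nonnegative and measurable).

HONEST FRAMING.  Helper lane of K1⁹; count-neutral; [folklore] measure theory by name; NO chart constructed, NO Jacobian computed, NO Gaussian integration performed — `hpush_y`,
`hsec_y`, the reading identity are HYPOTHESES a chart ∕ §3-supplier seat discharges ([I] §2 + [15] Sect. C + [III] Thm 2); nothing of Bałaban asserted; N11 NOT discharged;
K1⁹ NOT closed, no registered stub touched; counts unmoved (typed 28∕28 · discharged 5∕27 · A 5∕28).  One finite `𝕋⁴_{L^K}` programme at fixed `ε = L^{−K}` — NOT ℝ⁴, NOT OS,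
NOT a mass gap, NOT Clay.  No `sorry`, `axiom`, `def`, `instance`, `notation`.  Sources (SHAPE only): [I] (0.4) p.253, §2 pp.260–267; [III] (2.21) p.258, (3.1) p.264, p.267
L18–24, (3.23)–(3.25) p.270; [15] (47)–(49) pp.287–288.
-/

noncomputable section

open MeasureTheory ProbabilityTheory
open scoped ENNReal NNReal BigOperators

namespace Summit.QuantumFields.YangMills.Theorems.BalabanUVNodesN11FibrewiseIdentityOfFibreChart

open Literature.MathematicalPhysics.QuantumFieldTheory.Balaban1983to89
open Literature.MathematicalPhysics.QuantumFieldTheory.Balaban1983to89.T4AveragingDisintegration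
open BalabanUVNodesN11CondExpOfFibrewiseIdentity (weak_of_fibrewise_of_nonneg_at_record condExp_identity_of_fibrewise_of_nonneg)
open Node00 hiding SU
open Node00.Tk T4Continuum
open B10Eq42TorusConstraint (bondsIn)

/-! ## §1  One fibre, generic: the fibrewise identity from a fibre chart and a reading identity -/

section OneFibre

variable {U V X : Type*} [MeasurableSpace U] [MeasurableSpace V] [MeasurableSpace X]
variable {ν : Measure U} {μ₂ : Measure V} [SFinite μ₂] {κ : Kernel V X} [IsSFiniteKernel κ]
variable {avg : U → V} {Ψ : V × X → U} {J : V × X → ℝ≥0} {S : Set U}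

/-- ★ **THE FIBREWISE IDENTITY FROM A FIBRE CHART AND A READING IDENTITY** (one fibre): if `(κ, Ψ, J, S)` charts `ν` along `avg` (`hpush`: `dν|_S = J dμ₂ κ(dx)` through `Ψ`;
`hsec`: `Ψ(v,·)` parametrises the fibre `avg = v`), `ρ` is `ν`-integrable and vanishes off `S` (NO Borel measurability asked: the integrable class suffices), and the candidate
`R` is `μ₂`-a.e. the chart integral `v ↦ ∫ J(v,x)·ρ(Ψ(v,x)) κ(v,dx)`, then `∫ ρ(u)·h(avg u) dν = ∫ R(v)·h(v) dμ₂` for every bounded measurable `h` (push-forward, `withDensity`,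
Fubini for `μ₂ ⊗ₘ κ`; the fibre hypothesis replaces `h(avg(Ψ(v,x)))` by `h(v)` wherever `J ≠ 0`). [cite: Balaban1987RG1, (0.4) p.253, §2 p.267; Balaban1988Convergent, (3.1) p.264, p.267; Balaban1985Variational, (47)–(49) pp.287–288] -/
theorem fibre_identity_of_chart (havg : Measurable avg) (hΨ : Measurable Ψ) (hJ : Measurable J)
    (hpush : ((μ₂ ⊗ₘ κ).withDensity (fun z => (J z : ℝ≥0∞))).map Ψ = ν.restrict S)
    (hsec : ∀ᵐ z ∂((μ₂ ⊗ₘ κ).withDensity (fun z => (J z : ℝ≥0∞))), avg (Ψ z) = z.1)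
    {ρ : U → ℝ} (hρ : Integrable ρ ν) (hρS : ∀ u, u ∉ S → ρ u = 0)
    {R : V → ℝ} (hread : (fun v => ∫ x, (J (v, x) : ℝ) * ρ (Ψ (v, x)) ∂(κ v)) =ᵐ[μ₂] R)
    (h : V → ℝ) (hh : Measurable h) (hC : ∃ C : ℝ, ∀ v, |h v| ≤ C) :
    ∫ u, ρ u * h (avg u) ∂ν = ∫ v, R v * h v ∂μ₂ := by
  obtain ⟨C, hC⟩ := hC
  -- the tested integrand is integrable and lives on `S`
  have hI0 : Integrable (fun u => ρ u * h (avg u)) ν :=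
    hρ.mul_bdd (hh.comp havg).aestronglyMeasurable (Filter.Eventually.of_forall fun u => by simpa [Real.norm_eq_abs] using hC (avg u))
  have hI0' : Integrable (fun u => ρ u * h (avg u)) (ν.restrict S) := hI0.mono_measure Measure.restrict_le_self
  have hL : ∫ u, ρ u * h (avg u) ∂ν = ∫ u, ρ u * h (avg u) ∂(ν.restrict S) := by
    rw [setIntegral_eq_integral_of_forall_compl_eq_zero]
    intro u hu
    rw [hρS u hu, zero_mul]
  rw [← hpush] at hI0'
  have hasm : AEStronglyMeasurable (fun u => ρ u * h (avg u)) (((μ₂ ⊗ₘ κ).withDensity (fun z => (J z : ℝ≥0∞))).map Ψ) := hI0'.aestronglyMeasurable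
  -- pull back through the chart and the Jacobian density
  have hI1 : Integrable (fun z => (J z : ℝ) * (ρ (Ψ z) * h (avg (Ψ z)))) (μ₂ ⊗ₘ κ) := by
    have h1 := (integrable_map_measure hasm hΨ.aemeasurable).1 hI0'
    have h2 := (integrable_withDensity_iff_integrable_smul hJ).1 h1
    simpa only [NNReal.smul_def, smul_eq_mul, Function.comp_apply] using h2
  rw [hL, ← hpush, integral_map hΨ.aemeasurable hasm, integral_withDensity_eq_integral_smul hJ]
  -- replace `h (avg (Ψ z))` by `h z.1` where the Jacobian does not vanish
  have hsec' : ∀ᵐ z ∂(μ₂ ⊗ₘ κ), (J z : ℝ≥0∞) ≠ 0 → avg (Ψ z) = z.1 := (ae_withDensity_iff (by fun_prop)).1 hsec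
  have h2 : (fun z => J z • (ρ (Ψ z) * h (avg (Ψ z)))) =ᵐ[μ₂ ⊗ₘ κ] fun z => h z.1 * ((J z : ℝ) * ρ (Ψ z)) := by
    filter_upwards [hsec'] with z hz
    by_cases hJz : J z = 0
    · simp only [hJz, zero_smul, NNReal.coe_zero, zero_mul, mul_zero]
    · rw [hz (by exact_mod_cast hJz), NNReal.smul_def, smul_eq_mul]; ring
  have hI2 : Integrable (fun z => h z.1 * ((J z : ℝ) * ρ (Ψ z))) (μ₂ ⊗ₘ κ) := by
    refine (hI1.congr ?_).congr h2
    exact Filter.Eventually.of_forall fun z => by simp only [NNReal.smul_def, smul_eq_mul]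
  rw [integral_congr_ae h2, Measure.integral_compProd hI2]
  refine integral_congr_ae ?_
  filter_upwards [hread] with v hv
  change ∫ x, h v * ((J (v, x) : ℝ) * ρ (Ψ (v, x))) ∂(κ v) = R v * h v
  rw [integral_const_mul, mul_comm]
  exact congrArg (· * h v) hv

omit [SFinite μ₂] [IsSFiniteKernel κ] in
/-- The charted set may be everything: `hpush` with `ν` itself (no support clause). [folklore] -/
theorem restrict_univ_form (hpush : ((μ₂ ⊗ₘ κ).withDensity (fun z => (J z : ℝ≥0∞))).map Ψ = ν) :
    ((μ₂ ⊗ₘ κ).withDensity (fun z => (J z : ℝ≥0∞))).map Ψ = ν.restrict Set.univ := by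
  rw [Measure.restrict_univ]; exact hpush

/-- `fibre_identity_of_chart` with the charted set `univ` (a global chart of the fibre space: no support clause on `ρ`). [folklore] -/
theorem fibre_identity_of_chart_univ (havg : Measurable avg) (hΨ : Measurable Ψ) (hJ : Measurable J)
    (hpush : ((μ₂ ⊗ₘ κ).withDensity (fun z => (J z : ℝ≥0∞))).map Ψ = ν)
    (hsec : ∀ᵐ z ∂((μ₂ ⊗ₘ κ).withDensity (fun z => (J z : ℝ≥0∞))), avg (Ψ z) = z.1)
    {ρ : U → ℝ} (hρ : Integrable ρ ν)
    {R : V → ℝ} (hread : (fun v => ∫ x, (J (v, x) : ℝ) * ρ (Ψ (v, x)) ∂(κ v)) =ᵐ[μ₂] R)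
    (h : V → ℝ) (hh : Measurable h) (hC : ∃ C : ℝ, ∀ v, |h v| ≤ C) :
    ∫ u, ρ u * h (avg u) ∂ν = ∫ v, R v * h v ∂μ₂ :=
  fibre_identity_of_chart havg hΨ hJ (restrict_univ_form hpush) hsec hρ (fun u hu => absurd (Set.mem_univ u) hu) hread h hh hC

end OneFibre

/-! ## §2  Record letters: a `y`-parametrised family of fibre charts, no measurability in `y` -/

section Record

variable {F : T4Family} {N : ℕ} [NeZero N]
variable {X : Type*} [MeasurableSpace X]

/-- ★★ **THE FROZEN-`y` FIBREWISE IDENTITY AT THE RECORD LETTERS FROM A `y`-PARAMETRISED FAMILY OF FIBRE CHARTS** (ANY `dU`-integrable `ρ`, any finite bond sets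
`sV`, `sV'`): if for `(⊗_{sV} dU)`-a.e. `y` the data `(κ y, Ψ y, J y, S y)` chart the inside Haar product along `φ_y = (c ↦ Ū(e⁻¹(y,·))(c))_{c ∉ sV'}` (measurable, `hpush_y`,
`hsec_y`), `ρ(e⁻¹(y,·))` vanishes off `S y`, and the candidate `R(y,·)` is a.e. the chart integral, then (hfib) of `…N11CondExpOfFibrewiseIdentity` holds. Nothing is asked of the
family in the parameter `y`. [cite: Balaban1987RG1, (0.4) p.253, §2 p.267; Balaban1988Convergent, (3.1) p.264, (3.10)–(3.14) p.267, (3.23)–(3.25) p.270; Balaban1985Variational, (47)–(49) pp.287–288] -/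
theorem fibrewise_at_record_of_fibreCharts (K k : ℕ) {hdec : DecidableEq (PBond (F.P K) k)} {hdec' : DecidableEq (PBond (F.P K) (k + 1))}
    (sV : Finset (PBond (F.P K) k)) (sV' : Finset (PBond (F.P K) (k + 1)))
    {ρ : GaugeField (F.P K) k (SU N) → ℝ} (hρ : Integrable ρ (fieldMeasure (F.P K) k (SU N)))
    {R : (↥sV → SU N) × ({c : PBond (F.P K) (k + 1) // c ∉ sV'} → SU N) → ℝ}
    (κ : (↥sV → SU N) → Kernel ({c : PBond (F.P K) (k + 1) // c ∉ sV'} → SU N) X) [hκ : ∀ y, IsSFiniteKernel (κ y)]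
    (Ψ : (↥sV → SU N) → ({c : PBond (F.P K) (k + 1) // c ∉ sV'} → SU N) × X → ({b : PBond (F.P K) k // b ∉ sV} → SU N))
    (J : (↥sV → SU N) → ({c : PBond (F.P K) (k + 1) // c ∉ sV'} → SU N) × X → ℝ≥0)
    (S : (↥sV → SU N) → Set ({b : PBond (F.P K) k // b ∉ sV} → SU N))
    (hchart : ∀ᵐ y ∂(Measure.pi fun _ : ↥sV => (HaarData.haar : Measure (SU N))),
      Measurable (Ψ y) ∧ Measurable (J y) ∧
      (((Measure.pi fun _ : {c : PBond (F.P K) (k + 1) // c ∉ sV'} => (HaarData.haar : Measure (SU N))) ⊗ₘ κ y).withDensity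
          (fun z => (J y z : ℝ≥0∞))).map (Ψ y) =
        (Measure.pi fun _ : {b : PBond (F.P K) k // b ∉ sV} => (HaarData.haar : Measure (SU N))).restrict (S y) ∧
      (∀ᵐ z ∂(((Measure.pi fun _ : {c : PBond (F.P K) (k + 1) // c ∉ sV'} => (HaarData.haar : Measure (SU N))) ⊗ₘ κ y).withDensity
          (fun z => (J y z : ℝ≥0∞))),
        (fun c : {c : PBond (F.P K) (k + 1) // c ∉ sV'} =>
          (avOfRecord F N K k).avg ((MeasurableEquiv.piEquivPiSubtypeProd (fun _ : PBond (F.P K) k => SU N) (· ∈ sV)).symm (y, Ψ y z)) c) = z.1) ∧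
      (∀ u, u ∉ S y → ρ ((MeasurableEquiv.piEquivPiSubtypeProd (fun _ : PBond (F.P K) k => SU N) (· ∈ sV)).symm (y, u)) = 0) ∧
      ((fun v => ∫ x, (J y (v, x) : ℝ) * ρ ((MeasurableEquiv.piEquivPiSubtypeProd (fun _ : PBond (F.P K) k => SU N) (· ∈ sV)).symm (y, Ψ y (v, x))) ∂(κ y v))
        =ᵐ[Measure.pi fun _ : {c : PBond (F.P K) (k + 1) // c ∉ sV'} => (HaarData.haar : Measure (SU N))] fun v => R (y, v))) :
    ∀ᵐ y ∂(Measure.pi fun _ : ↥sV => (HaarData.haar : Measure (SU N))),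
      ∀ h : ({c : PBond (F.P K) (k + 1) // c ∉ sV'} → SU N) → ℝ, Measurable h → (∃ C : ℝ, ∀ v, |h v| ≤ C) →
        ∫ u, ρ ((MeasurableEquiv.piEquivPiSubtypeProd (fun _ : PBond (F.P K) k => SU N) (· ∈ sV)).symm (y, u)) *
            h (fun c : {c : PBond (F.P K) (k + 1) // c ∉ sV'} =>
              (avOfRecord F N K k).avg ((MeasurableEquiv.piEquivPiSubtypeProd (fun _ : PBond (F.P K) k => SU N) (· ∈ sV)).symm (y, u)) c)
          ∂(Measure.pi fun _ : {b : PBond (F.P K) k // b ∉ sV} => (HaarData.haar : Measure (SU N))) =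
        ∫ v, R (y, v) * h v ∂(Measure.pi fun _ : {c : PBond (F.P K) (k + 1) // c ∉ sV'} => (HaarData.haar : Measure (SU N))) := by
  have hpres := measurePreserving_piEquivPiSubtypeProd_symm_fieldMeasure (G := SU N) (P := F.P K) (j := k) sV
  have hρ' := (hpres.integrable_comp hρ.aestronglyMeasurable).mpr hρ
  have hφ := measurable_avOfRecord_glue_rest F N K k sV sV'
  filter_upwards [hchart, hρ'.prod_right_ae] with y ⟨hΨ, hJ, hpush, hsec, hρS, hread⟩ hρy h hh hC
  exact fibre_identity_of_chart (μ₂ := Measure.pi fun _ : {c : PBond (F.P K) (k + 1) // c ∉ sV'} => (HaarData.haar : Measure (SU N))) (κ := κ y)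
    (hφ.comp measurable_prodMk_left) hΨ hJ hpush hsec hρy hρS hread h hh hC

/-- ★★★ **p646357's (hweak) FROM A `y`-PARAMETRISED FAMILY OF FIBRE CHARTS** (candidate nonnegative and measurable; any finite bond sets): §2 ∘ the Fubini reduction
`…N11CondExpOfFibrewiseIdentity.weak_of_fibrewise_of_nonneg_at_record`. [cite: Balaban1987RG1, (0.4) p.253, §2 p.267; Balaban1988Convergent, (3.1) p.264, (3.23)–(3.25) p.270; Balaban1985Variational, (47)–(49) pp.287–288] -/
theorem weak_at_record_of_fibreCharts (K k : ℕ) {hdec : DecidableEq (PBond (F.P K) k)} {hdec' : DecidableEq (PBond (F.P K) (k + 1))}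
    (sV : Finset (PBond (F.P K) k)) (sV' : Finset (PBond (F.P K) (k + 1)))
    {ρ : GaugeField (F.P K) k (SU N) → ℝ} (hρ : Integrable ρ (fieldMeasure (F.P K) k (SU N)))
    {R : (↥sV → SU N) × ({c : PBond (F.P K) (k + 1) // c ∉ sV'} → SU N) → ℝ}
    (κ : (↥sV → SU N) → Kernel ({c : PBond (F.P K) (k + 1) // c ∉ sV'} → SU N) X) [hκ : ∀ y, IsSFiniteKernel (κ y)]
    (Ψ : (↥sV → SU N) → ({c : PBond (F.P K) (k + 1) // c ∉ sV'} → SU N) × X → ({b : PBond (F.P K) k // b ∉ sV} → SU N))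
    (J : (↥sV → SU N) → ({c : PBond (F.P K) (k + 1) // c ∉ sV'} → SU N) × X → ℝ≥0)
    (S : (↥sV → SU N) → Set ({b : PBond (F.P K) k // b ∉ sV} → SU N))
    (hchart : ∀ᵐ y ∂(Measure.pi fun _ : ↥sV => (HaarData.haar : Measure (SU N))),
      Measurable (Ψ y) ∧ Measurable (J y) ∧
      (((Measure.pi fun _ : {c : PBond (F.P K) (k + 1) // c ∉ sV'} => (HaarData.haar : Measure (SU N))) ⊗ₘ κ y).withDensity
          (fun z => (J y z : ℝ≥0∞))).map (Ψ y) =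
        (Measure.pi fun _ : {b : PBond (F.P K) k // b ∉ sV} => (HaarData.haar : Measure (SU N))).restrict (S y) ∧
      (∀ᵐ z ∂(((Measure.pi fun _ : {c : PBond (F.P K) (k + 1) // c ∉ sV'} => (HaarData.haar : Measure (SU N))) ⊗ₘ κ y).withDensity
          (fun z => (J y z : ℝ≥0∞))),
        (fun c : {c : PBond (F.P K) (k + 1) // c ∉ sV'} =>
          (avOfRecord F N K k).avg ((MeasurableEquiv.piEquivPiSubtypeProd (fun _ : PBond (F.P K) k => SU N) (· ∈ sV)).symm (y, Ψ y z)) c) = z.1) ∧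
      (∀ u, u ∉ S y → ρ ((MeasurableEquiv.piEquivPiSubtypeProd (fun _ : PBond (F.P K) k => SU N) (· ∈ sV)).symm (y, u)) = 0) ∧
      ((fun v => ∫ x, (J y (v, x) : ℝ) * ρ ((MeasurableEquiv.piEquivPiSubtypeProd (fun _ : PBond (F.P K) k => SU N) (· ∈ sV)).symm (y, Ψ y (v, x))) ∂(κ y v))
        =ᵐ[Measure.pi fun _ : {c : PBond (F.P K) (k + 1) // c ∉ sV'} => (HaarData.haar : Measure (SU N))] fun v => R (y, v)))
    (hR0 : ∀ z, 0 ≤ R z) (hRm : Measurable R)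
    (f : (↥sV → SU N) × ({c : PBond (F.P K) (k + 1) // c ∉ sV'} → SU N) → ℝ) (hf : Measurable f) (hC : ∃ C : ℝ, ∀ z, |f z| ≤ C) :
    ∫ q, (ρ ∘ ⇑(MeasurableEquiv.piEquivPiSubtypeProd (fun _ : PBond (F.P K) k => SU N) (· ∈ sV)).symm) q *
        f ((fun q => (q.1, fun c : {c : PBond (F.P K) (k + 1) // c ∉ sV'} =>
          (avOfRecord F N K k).avg ((MeasurableEquiv.piEquivPiSubtypeProd (fun _ : PBond (F.P K) k => SU N) (· ∈ sV)).symm q) c)) q)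
        ∂((Measure.pi fun _ : ↥sV => (HaarData.haar : Measure (SU N))).prod
          (Measure.pi fun _ : {b : PBond (F.P K) k // b ∉ sV} => (HaarData.haar : Measure (SU N)))) =
      ∫ z, R z * f z ∂((Measure.pi fun _ : ↥sV => (HaarData.haar : Measure (SU N))).prod
          (Measure.pi fun _ : {c : PBond (F.P K) (k + 1) // c ∉ sV'} => (HaarData.haar : Measure (SU N)))) :=
  weak_of_fibrewise_of_nonneg_at_record K k (hdec := hdec) (hdec' := hdec') sV sV' hρ hR0 hRm
    (fibrewise_at_record_of_fibreCharts K k (hdec := hdec) (hdec' := hdec') sV sV' hρ κ Ψ J S hchart) f hf hC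

/-- ★★★ **(hce₀) AT 11a's GENERATION LETTERS FROM A `y`-PARAMETRISED FAMILY OF FIBRE CHARTS** (`sV = B_k(Ω^c_{k+1}(s′))`, `sV' = B_{k+1}(Ω^c_{k+1}(s′))`; candidate nonnegative and
measurable): def-T's skew conditional expectation of `ρ ∘ e⁻¹` IS `R`, `μ_out`-a.e. — §2 ∘ `…N11CondExpOfFibrewiseIdentity.condExp_identity_of_fibrewise_of_nonneg`.  Per frozen `y`:
ONE chart, ONE support clause, ONE reading identity; nothing in the parameter `y`. [cite: Balaban1987RG1, (0.4) p.253, §2 p.267; Balaban1988Convergent, (2.21) p.258, (3.1) p.264, p.267, (3.23)–(3.25) p.270; Balaban1985Variational, (47)–(49) pp.287–288] -/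
theorem condExp_identity_of_fibreCharts_of_nonneg (ν : Stage7Numerics) (M : ℕ) (g : ℕ → ℝ) (p : B12.RunParams)
    {k : ℕ} {hdec : DecidableEq (PBond (F.P p.K) k)} {hdec' : DecidableEq (PBond (F.P p.K) (k + 1))} (hk : k + 1 ≤ (F.P p.K).m + (F.P p.K).K)
    (s' : SeqOfRecord F ν M g p.K (k + 1))
    {ρ : GaugeField (F.P p.K) k (SU N) → ℝ} (hρ : Integrable ρ (fieldMeasure (F.P p.K) k (SU N)))
    {R : (↥(Set.toFinite (bondsIn k (s'.Ω (k + 1))ᶜ)).toFinset → SU N) × ({c : PBond (F.P p.K) (k + 1) // c ∉ (Set.toFinite (bondsIn (k + 1) (s'.Ω (k + 1))ᶜ)).toFinset} → SU N) → ℝ}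
    (κ : (↥(Set.toFinite (bondsIn k (s'.Ω (k + 1))ᶜ)).toFinset → SU N) → Kernel ({c : PBond (F.P p.K) (k + 1) // c ∉ (Set.toFinite (bondsIn (k + 1) (s'.Ω (k + 1))ᶜ)).toFinset} → SU N) X) [hκ : ∀ y, IsSFiniteKernel (κ y)]
    (Ψ : (↥(Set.toFinite (bondsIn k (s'.Ω (k + 1))ᶜ)).toFinset → SU N) → ({c : PBond (F.P p.K) (k + 1) // c ∉ (Set.toFinite (bondsIn (k + 1) (s'.Ω (k + 1))ᶜ)).toFinset} → SU N) × X → ({b : PBond (F.P p.K) k // b ∉ (Set.toFinite (bondsIn k (s'.Ω (k + 1))ᶜ)).toFinset} → SU N))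
    (J : (↥(Set.toFinite (bondsIn k (s'.Ω (k + 1))ᶜ)).toFinset → SU N) → ({c : PBond (F.P p.K) (k + 1) // c ∉ (Set.toFinite (bondsIn (k + 1) (s'.Ω (k + 1))ᶜ)).toFinset} → SU N) × X → ℝ≥0)
    (S : (↥(Set.toFinite (bondsIn k (s'.Ω (k + 1))ᶜ)).toFinset → SU N) → Set ({b : PBond (F.P p.K) k // b ∉ (Set.toFinite (bondsIn k (s'.Ω (k + 1))ᶜ)).toFinset} → SU N))
    (hchart : ∀ᵐ y ∂(Measure.pi fun _ : ↥(Set.toFinite (bondsIn k (s'.Ω (k + 1))ᶜ)).toFinset => (HaarData.haar : Measure (SU N))),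
      Measurable (Ψ y) ∧ Measurable (J y) ∧
      (((Measure.pi fun _ : {c : PBond (F.P p.K) (k + 1) // c ∉ (Set.toFinite (bondsIn (k + 1) (s'.Ω (k + 1))ᶜ)).toFinset} => (HaarData.haar : Measure (SU N))) ⊗ₘ κ y).withDensity
          (fun z => (J y z : ℝ≥0∞))).map (Ψ y) =
        (Measure.pi fun _ : {b : PBond (F.P p.K) k // b ∉ (Set.toFinite (bondsIn k (s'.Ω (k + 1))ᶜ)).toFinset} => (HaarData.haar : Measure (SU N))).restrict (S y) ∧
      (∀ᵐ z ∂(((Measure.pi fun _ : {c : PBond (F.P p.K) (k + 1) // c ∉ (Set.toFinite (bondsIn (k + 1) (s'.Ω (k + 1))ᶜ)).toFinset} => (HaarData.haar : Measure (SU N))) ⊗ₘ κ y).withDensity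
          (fun z => (J y z : ℝ≥0∞))),
        (fun c : {c : PBond (F.P p.K) (k + 1) // c ∉ (Set.toFinite (bondsIn (k + 1) (s'.Ω (k + 1))ᶜ)).toFinset} =>
          (avOfRecord F N p.K k).avg ((MeasurableEquiv.piEquivPiSubtypeProd (fun _ : PBond (F.P p.K) k => SU N) (· ∈ (Set.toFinite (bondsIn k (s'.Ω (k + 1))ᶜ)).toFinset)).symm (y, Ψ y z)) c) = z.1) ∧
      (∀ u, u ∉ S y → ρ ((MeasurableEquiv.piEquivPiSubtypeProd (fun _ : PBond (F.P p.K) k => SU N) (· ∈ (Set.toFinite (bondsIn k (s'.Ω (k + 1))ᶜ)).toFinset)).symm (y, u)) = 0) ∧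
      ((fun v => ∫ x, (J y (v, x) : ℝ) * ρ ((MeasurableEquiv.piEquivPiSubtypeProd (fun _ : PBond (F.P p.K) k => SU N) (· ∈ (Set.toFinite (bondsIn k (s'.Ω (k + 1))ᶜ)).toFinset)).symm (y, Ψ y (v, x))) ∂(κ y v))
        =ᵐ[Measure.pi fun _ : {c : PBond (F.P p.K) (k + 1) // c ∉ (Set.toFinite (bondsIn (k + 1) (s'.Ω (k + 1))ᶜ)).toFinset} => (HaarData.haar : Measure (SU N))] fun v => R (y, v)))
    (hR0 : ∀ z, 0 ≤ R z) (hRm : Measurable R) :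
    kernelTransport
        ((Measure.pi fun _ : ↥(Set.toFinite (bondsIn k (s'.Ω (k + 1))ᶜ)).toFinset => (HaarData.haar : Measure (SU N))).prod
          (Measure.pi fun _ : {b : PBond (F.P p.K) k // b ∉ (Set.toFinite (bondsIn k (s'.Ω (k + 1))ᶜ)).toFinset} => (HaarData.haar : Measure (SU N))))
        ((Measure.pi fun _ : ↥(Set.toFinite (bondsIn k (s'.Ω (k + 1))ᶜ)).toFinset => (HaarData.haar : Measure (SU N))).prod
          (Measure.pi fun _ : {c : PBond (F.P p.K) (k + 1) // c ∉ (Set.toFinite (bondsIn (k + 1) (s'.Ω (k + 1))ᶜ)).toFinset} =>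
            (HaarData.haar : Measure (SU N))))
        (fun q => (q.1, fun c : {c : PBond (F.P p.K) (k + 1) // c ∉ (Set.toFinite (bondsIn (k + 1) (s'.Ω (k + 1))ᶜ)).toFinset} =>
          (avOfRecord F N p.K k).avg
            ((MeasurableEquiv.piEquivPiSubtypeProd (fun _ : PBond (F.P p.K) k => SU N)
              (· ∈ (Set.toFinite (bondsIn k (s'.Ω (k + 1))ᶜ)).toFinset)).symm q) c))
        (ρ ∘ ⇑(MeasurableEquiv.piEquivPiSubtypeProd (fun _ : PBond (F.P p.K) k => SU N)
            (· ∈ (Set.toFinite (bondsIn k (s'.Ω (k + 1))ᶜ)).toFinset)).symm)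
      =ᵐ[((Measure.pi fun _ : ↥(Set.toFinite (bondsIn k (s'.Ω (k + 1))ᶜ)).toFinset => (HaarData.haar : Measure (SU N))).prod
          (Measure.pi fun _ : {c : PBond (F.P p.K) (k + 1) // c ∉ (Set.toFinite (bondsIn (k + 1) (s'.Ω (k + 1))ᶜ)).toFinset} =>
            (HaarData.haar : Measure (SU N))))] R :=
  condExp_identity_of_fibrewise_of_nonneg ν M g p (hdec := hdec) (hdec' := hdec') hk s' hρ hR0 hRm
    (fibrewise_at_record_of_fibreCharts p.K k (hdec := hdec) (hdec' := hdec') _ _ hρ κ Ψ J S hchart)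

end Record

end Summit.QuantumFields.YangMills.Theorems.BalabanUVNodesN11FibrewiseIdentityOfFibreChart

end
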